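import Literature.AnabelianGeometry.AbsoluteAnabelian.AbsTopIThm26vFullCore
import Literature.AnabelianGeometry.AbsoluteAnabelian.AbsTopIThm26iiiTransportProofs
import Literature.AnabelianGeometry.AbsoluteAnabelian.MLFGaloisElasticProofs
import Literature.AnabelianGeometry.AbsoluteAnabelian.AbsAnabLemma114Proofs
import Literature.AnabelianGeometry.AbsoluteAnabelian.AbsTopIRankFormulaProofs
import Literature.AnabelianGeometry.AbsoluteAnabelian.AbsTopIThm26iProSigmaProofs
import Mathlib.Topology.Algebra.ClopenNhdofOne
import HarnessLib

/-!
# [AbsTopI] Thm 2.6 (v), GENERAL form (`Θ ⊆ Π`, `ζ̃(Π) := ζ(Π/Θ)`): a closer for `Thm26vFull`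

S. Mochizuki, *Topics in Absolute Anabelian Geometry I: Generalities* (2012) [AbsTopI], Thm 2.6 (v),
manuscript p. 22 (lit key `paper:url-11ac98ba15fc`):

  "(v) Let `k` be as in (ii) [an MLF]. If `θ²(Π) ≠ Primes`, then write `Θ ⊆ Π` for the maximal almost
  pro-omissive topologically finitely generated closed normal subgroup of `Π`, whenever a unique such
  maximal subgroup exists; if `θ²(Π) = Primes`, or there does not exist a unique such maximal subgroup,
  set `Θ := {1} ⊆ Π`.  Then `ζ̃(Π) := ζ(Π/Θ) = [k : ℚ_p]` [cf. the finiteness portion of (ii)].  In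
  particular, the kernel of the quotient `Π ↠ G` may be characterized ["group-theoretically" — since
  "`θ²(−)`", "`ζ(−)`", "`ζ̃(−)`" are "group-theoretic"] as the intersection of the open subgroups
  `H ⊆ Π` such that `ζ̃(H)/ζ̃(Π) = [Π : H]`."

abc-iut-L4-t4 typed the GENERAL form as `FundamentalExtension.Thm26vFull B` (`AbsTopIThm26iii.lean`
l. 133); so far the tree held only the bridge `thm26vFull_fst_iff_of_thetaSet_two_eq` to the special
case `Θ = {1}` (`Thm26v`, discharged in `AbsTopIThm26vProofs.lean`).  This PROOF-ONLY companion (no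
definitions, no named facts) CLOSES the general form for EVERY abstract extension
`1 → Δ → Π → G → 1` with MLF base data `G ≅ G_K`, modulo the printed inputs BY NAME:

* (I1) `Δ` topologically finitely generated — [AbsTopI] Prop 2.2 (`E.GeomTFG`);
* (I2) `Δ` pro-`Σ`, `Σ ⊆ Primes` — the construction datum of Def 2.1 (i) (`IsProSet E.geom S`);
* (I3) the rank identity of the proof of (ii) (p. 23 l. 17–20, "`δ¹_l(Π) = δ¹_l(G) + dim_{ℚ_l}(Q_l ⊗ ℚ_l)`
  [independent of `l`] for `l ∈ Σ`") for every open `Π′ ⊆ Π` — the `hQ` shape of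
  `thm26ii_of_isProSet_of_rank`;
* (I4) Thm 2.6 (iii) for every open `H ⊆ Π`, print-literal (`thetaSet H 2 ⊆ Σ`,
  `2 ≤ |thetaSet H 1| → thetaSet H 2 = Σ`) — at `H = Π` the typed `E.Thm26iii S`.

Everything else in the printed proof (p. 24 l. 1–22) is a THEOREM of the tree used by name: elasticity
of `G_k` ([AbsTopI] Thm 1.7 (ii), `MLFBase.isElastic_gal`), "no almost pro-omissive open subgroup of
`G_k`" (`MLFBase.not_isAlmostProOmissive_of_isOpen`), the LCFT ranks `δ¹_l(G′) = 1`,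
`δ¹_p(G′) = [G : G′]·[K : ℚ_p] + 1` of every open `G′ ⊆ G` (`thm26_ii_delta_gal_holds`,
`freeProlRank_map_aug_of_rank`), `δ¹_l = dim H¹(−, ℚ_l)` (`deltaInv_one_eq_freeProlRank`), `Δ ∩ H`
pro-`Σ` (`isProSet_geom_inf_of_isOpen`) and tfg (`IsTopologicallyFinitelyGenerated.subgroup_isOpen`).

* `MLFBase.eq_bot_of_isAlmostProOmissive_of_isOpen` / `…_of_isAlmostProOmissive` — the mechanism of
  (iv): inside an open `U ⊆ G ≅ G_k` (resp. in `G`) every almost pro-omissive tfg closed normal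
  subgroup is trivial;
* `MLFBase.zetaTildeInv_eq_of_isOpen` — `ζ̃(H) = [G : G_H]·[K : ℚ_p]` for every open `H ⊆ Π`;
* `MLFBase.zetaTildeInv_arith_eq` — `ζ̃(Π) = [K : ℚ_p]`;
* **`MLFBase.thm26vFull_of_rank_of_thm26iii_open : … → E.Thm26vFull B`** — both printed sentences.

HONEST FRAMING: a refereed, undisputed statement, closed MODULO the named inputs (I3) (rank identity
of (ii) for open subgroups) and (I4) ((iii) for open subgroups); abc-iut cell, block C seat
abc-iut-w6-d034 (L4-lead RULING #7k «THM26V-FULL-CLOSE»); nothing here bears on [IUTchIII] Cor. 3.12;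
typed ≠ proved elsewhere.
-/

noncomputable section

open Topology

namespace Literature.AnabelianGeometry.AbsoluteAnabelian

universe u v

/-! ### The extension `1 → Δ → Π → G → 1` with MLF base data -/

namespace FundamentalExtension

variable {E : FundamentalExtension.{0}}

/-- For surjective `f`, `[f(G) : f(H)] = [G : H]` (finite) iff `Ker f ⊆ H`. [folklore] -/
private theorem index_map_eq_iff_ker_le' {G : Type u} {G' : Type v} [Group G] [Group G'] (f : G →* G')
    (hf : Function.Surjective f) (H : Subgroup G) [H.FiniteIndex] :
    (H.map f).index = H.index ↔ f.ker ≤ H := by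
  refine ⟨fun h => ?_, fun h => Subgroup.index_map_eq H hf h⟩
  have h1 : (H.map f).index = (H ⊔ f.ker).index := by
    rw [Subgroup.index_map, MonoidHom.range_eq_top.mpr hf, Subgroup.index_top, mul_one]
  rw [h1] at h
  have h2 : H.relIndex (H ⊔ f.ker) * (H ⊔ f.ker).index = H.index :=
    Subgroup.relIndex_mul_index le_sup_left
  rw [h] at h2
  have h3 : H.relIndex (H ⊔ f.ker) = 1 := by
    have hne : H.index ≠ 0 := Subgroup.FiniteIndex.index_ne_zero
    have := h2
    nth_rw 2 [← one_mul H.index] at this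
    exact Nat.eq_of_mul_eq_mul_right (Nat.pos_of_ne_zero hne) this
  exact le_sup_right.trans (Subgroup.relIndex_eq_one.mp h3)

/-- **`G_k` has no nontrivial almost pro-omissive topologically finitely generated closed normal
subgroup inside any OPEN subgroup** — the mechanism of [AbsTopI] Thm 2.6 (iv) (p. 24 l. 1–3:
"the existence of a surjection `G ↠ Ẑ` [...], together with the elasticity of `G` [Thm 1.7 (ii)]"):
such a subgroup `M ⊴ U`, `U ⊆ G` open, is trivial or of finite index by elasticity
(`MLFBase.isElastic_gal`), and a finite-index one would be an almost pro-omissive OPEN subgroup of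
`G ≅ G_k` (`MLFBase.not_isAlmostProOmissive_of_isOpen`). [cite: MochizukiAbsTopI2012, Thm 2.6 (iv) proof p.24] -/
theorem MLFBase.eq_bot_of_isAlmostProOmissive_of_isOpen (B : E.MLFBase) (U : Subgroup E.gal)
    (hU : IsOpen (U : Set E.gal)) (M : Subgroup U) (hMn : M.Normal) (hMc : IsClosed (M : Set U))
    (hMfg : IsTopologicallyFinitelyGenerated M) (hMapo : IsAlmostProOmissive M) : M = ⊥ := by
  have hUc : IsClosed (U : Set E.gal) := U.isClosed_of_isOpen hU
  haveI : CompactSpace U := isCompact_iff_compactSpace.mp hUc.isCompact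
  haveI : CompactSpace M := isCompact_iff_compactSpace.mp hMc.isCompact
  set M' : Subgroup E.gal := M.map U.subtype with hM'def
  have hle : M' ≤ U := Subgroup.map_subtype_le M
  have hnorm : (M'.subgroupOf U).Normal := by
    change ((M.map U.subtype).comap U.subtype).Normal
    rw [Subgroup.comap_map_eq_self_of_injective U.subtype_injective]
    exact hMn
  have hM'c : IsClosed (M' : Set E.gal) := by
    rw [hM'def, Subgroup.coe_map]
    exact hUc.isClosedEmbedding_subtypeVal.isClosedMap _ hMc
  let φ : M →ₜ* M' :=
    ⟨U.subtype.subgroupMap M, Continuous.subtype_mk (continuous_subtype_val.comp continuous_subtype_val) _⟩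
  have hφ : Function.Surjective φ := U.subtype.subgroupMap_surjective M
  have hM'fg : IsTopologicallyFinitelyGenerated M' := hMfg.of_surjective φ hφ
  have hM'apo : IsAlmostProOmissive M' := hMapo.of_surjective φ hφ
  rcases (MLFBase.isElastic_gal B).eq_bot_or_finiteIndex U M' hU hle hnorm hM'c hM'fg with hbot | hfin
  · -- `M' = 1`, hence `M = 1`
    refine (Subgroup.eq_bot_iff_forall _).mpr fun x hx => ?_
    have hx' : (x : E.gal) ∈ M' := ⟨x, hx, rfl⟩
    rw [hbot] at hx'
    exact Subtype.ext (Subgroup.mem_bot.mp hx')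
  · -- `M'` of finite index and closed, hence open: impossible
    haveI := hfin
    exact absurd hM'apo (MLFBase.not_isAlmostProOmissive_of_isOpen B M'
      (Subgroup.isOpen_of_isClosed_of_finiteIndex M' hM'c))

/-- The same for `G` itself: every almost pro-omissive topologically finitely generated closed
normal subgroup of `G ≅ G_k` is trivial. [cite: MochizukiAbsTopI2012, Thm 2.6 (iv) proof p.24] -/
theorem MLFBase.eq_bot_of_isAlmostProOmissive (B : E.MLFBase) (M : Subgroup E.gal) (hMn : M.Normal)
    (hMc : IsClosed (M : Set E.gal)) (hMfg : IsTopologicallyFinitelyGenerated M)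
    (hMapo : IsAlmostProOmissive M) : M = ⊥ := by
  have htop : IsOpen (((⊤ : Subgroup E.gal)) : Set E.gal) := by
    rw [Subgroup.coe_top]
    exact isOpen_univ
  haveI := hMn
  have hMn' : (M.subgroupOf ⊤).Normal := by
    refine (Subgroup.normal_subgroupOf_iff_le_normalizer le_top).mpr ?_
    rw [Subgroup.normalizer_eq_top M]
  rcases (MLFBase.isElastic_gal B).eq_bot_or_finiteIndex ⊤ M htop le_top hMn' hMc hMfg with hbot | hfin
  · exact hbot
  · haveI := hfin
    exact absurd hMapo (MLFBase.not_isAlmostProOmissive_of_isOpen B M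
      (Subgroup.isOpen_of_isClosed_of_finiteIndex M hMc))

/-- **`ζ̃(H) = [G : G_H] · [K : ℚ_p]` for every OPEN subgroup `H ⊆ Π`** ("`ζ̃(Π) = [k : ℚ_p]`" of
[AbsTopI] Thm 2.6 (v) applied, as its "In particular" clause does, to the open subgroup `H` with its
base field `k_H`, `[k_H : ℚ_p] = [G : G_H]·[K : ℚ_p]`): for an extension with MLF base data
`G ≅ G_K`, `Δ` topologically finitely generated (Prop 2.2) and pro-`Σ`, GIVEN the rank identity of
(ii) for `H` ("`δ¹_l(H) = δ¹_l(G_H) + m` for `l ∈ Σ`") and (iii) for `H`.  The inputs `Δ ∩ H` tfg and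
pro-`Σ`, the LCFT ranks of `G_H` (`freeProlRank_map_aug_of_rank` + `thm26_ii_delta_gal_holds`) and
the elasticity mechanism are theorems of the tree. [cite: MochizukiAbsTopI2012, Thm 2.6 (v) p.22] -/
theorem MLFBase.zetaTildeInv_eq_of_isOpen (B : E.MLFBase) (H : Subgroup E.arith)
    (hH : IsOpen (H : Set E.arith))
    {S : Set ℕ} (hS : S ⊆ {q | q.Prime}) (hΔ : E.GeomTFG) (hΔS : IsProSet E.geom S)
    (hQ : ∃ m : ℕ, ∀ (l : ℕ) [Fact l.Prime], l ∈ S →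
      freeProlRank H l = freeProlRank (H.map E.aug.toMonoidHom) l + m)
    (hiii : thetaSet H 2 ⊆ {l ∈ S | l.Prime} ∧
      (2 ≤ (thetaSet H 1).encard → thetaSet H 2 = {l ∈ S | l.Prime})) :
    zetaTildeInv H =
      (((H.map E.aug.toMonoidHom).index * Module.finrank ℚ_[B.p] B.K : ℕ) : ℕ∞) := by
  letI := B.instPrime; letI := B.instField; letI := B.instAlgebra; letI := B.instFinite
  have hHc : IsClosed (H : Set E.arith) := H.isClosed_of_isOpen hH
  haveI : CompactSpace H := isCompact_iff_compactSpace.mp hHc.isCompact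
  haveI : CompactSpace E.geom := isCompact_iff_compactSpace.mp E.isClosed_geom.isCompact
  -- the image `G_H ⊆ G`, open
  set GH : Subgroup E.gal := H.map E.aug.toMonoidHom with hGHdef
  haveI : Finite (E.arith ⧸ H) := Subgroup.quotient_finite_of_isOpen H hH
  haveI : H.FiniteIndex := Subgroup.finiteIndex_of_finite_quotient
  haveI : GH.FiniteIndex :=
    ⟨fun h0 => Subgroup.FiniteIndex.index_ne_zero (H := H)
      (Nat.eq_zero_of_zero_dvd (h0 ▸ Subgroup.index_map_dvd H E.aug_surjective))⟩
  have hGHc : IsClosed (GH : Set E.gal) := by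
    rw [hGHdef, Subgroup.coe_map]
    exact (hHc.isCompact.image (map_continuous E.aug)).isClosed
  have hGHo : IsOpen (GH : Set E.gal) := GH.isOpen_of_isClosed_of_finiteIndex hGHc
  -- the restricted augmentation `H ↠ G_H`
  let a : H →ₜ* GH :=
    ⟨E.aug.toMonoidHom.subgroupMap H,
      Continuous.subtype_mk ((map_continuous E.aug).comp continuous_subtype_val) _⟩
  have ha : Function.Surjective a := E.aug.toMonoidHom.subgroupMap_surjective H
  -- `Ker(H ↠ G_H) = Δ ∩ H`
  have hmem : ∀ y : H, y ∈ a.toMonoidHom.ker ↔ (y : E.arith) ∈ E.geom := by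
    intro y
    rw [MonoidHom.mem_ker, mem_geom, Subtype.ext_iff]
    rfl
  let e : ↥(E.geom ⊓ H) ≃ₜ* ↥(a.toMonoidHom.ker) :=
    { toFun := fun x => ⟨⟨x.1, x.2.2⟩, (hmem _).2 x.2.1⟩
      invFun := fun y => ⟨y.1.1, ⟨(hmem _).1 y.2, y.1.2⟩⟩
      left_inv := fun _ => rfl
      right_inv := fun _ => rfl
      map_mul' := fun _ _ => rfl
      continuous_toFun :=
        Continuous.subtype_mk (Continuous.subtype_mk continuous_subtype_val _) _
      continuous_invFun :=
        Continuous.subtype_mk (continuous_subtype_val.comp continuous_subtype_val) _ }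
  -- `Δ ∩ H` as an open subgroup of `Δ`: tfg and pro-`Σ`
  let V : Subgroup E.geom := (E.geom ⊓ H).subgroupOf E.geom
  have hVo : IsOpen (V : Set E.geom) := by
    have hV : (V : Set E.geom) = Subtype.val ⁻¹' (H : Set E.arith) := by
      ext x
      simp only [V, SetLike.mem_coe, Subgroup.mem_subgroupOf, Subgroup.mem_inf, Set.mem_preimage]
      exact ⟨fun h => h.2, fun h => ⟨x.2, h⟩⟩
    rw [hV]
    exact hH.preimage continuous_subtype_val
  let e₀ : V ≃* ↥(E.geom ⊓ H) := Subgroup.subgroupOfEquivOfLe inf_le_left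
  let e' : V ≃ₜ* ↥(E.geom ⊓ H) :=
    { e₀ with
      continuous_toFun := by
        refine Continuous.subtype_mk ?_ _
        exact continuous_subtype_val.comp continuous_subtype_val
      continuous_invFun := by
        refine Continuous.subtype_mk (Continuous.subtype_mk continuous_subtype_val _) _ }
  have hΔHfg : IsTopologicallyFinitelyGenerated (a.toMonoidHom.ker) :=
    ((hΔ.subgroup_isOpen V hVo).of_continuousMulEquiv e').of_continuousMulEquiv e
  have hΔHS : IsProSet (a.toMonoidHom.ker) S :=
    (E.isProSet_geom_inf_of_isOpen hΔS H hH).of_continuousMulEquiv e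
  -- LCFT ranks of `G_H`
  obtain ⟨hl1, hp1⟩ := freeProlRank_map_aug_of_rank thm26_ii_delta_gal_holds E B H hH
  have hp1' : @freeProlRank GH _ _ B.p B.instPrime =
      ((1 + GH.index * Module.finrank ℚ_[B.p] B.K : ℕ) : ℕ∞) := by
    rw [hp1, Nat.add_comm]
  -- the core
  exact zetaTildeInv_eq_of_inputs a ha
    (fun M hn hc hfg hapo => MLFBase.eq_bot_of_isAlmostProOmissive_of_isOpen B GH hGHo M hn hc hfg hapo)
    B.p (GH.index * Module.finrank ℚ_[B.p] B.K) hp1' hl1 hS hΔHfg hΔHS hQ hiii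

/-- **`ζ̃(Π) = [K : ℚ_p]`** — the first sentence of [AbsTopI] Thm 2.6 (v), general `Θ` — for an
extension with MLF base data `G ≅ G_K`, GIVEN `Δ` tfg (Prop 2.2) and pro-`Σ`, the rank identity of
(ii) ("`δ¹_l(Π) = δ¹_l(G) + m` for `l ∈ Σ`") and (iii) (typed `thetaSet` clauses) for `Π`.
[cite: MochizukiAbsTopI2012, Thm 2.6 (v) p.22] -/
theorem MLFBase.zetaTildeInv_arith_eq (B : E.MLFBase) {S : Set ℕ} (hS : S ⊆ {q | q.Prime})
    (hΔ : E.GeomTFG) (hΔS : IsProSet E.geom S)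
    (hQ : ∃ m : ℕ, ∀ (l : ℕ) [Fact l.Prime], l ∈ S →
      freeProlRank E.arith l = freeProlRank E.gal l + m)
    (hiii : thetaSet E.arith 2 ⊆ {l ∈ S | l.Prime} ∧
      (2 ≤ (thetaSet E.arith 1).encard → thetaSet E.arith 2 = {l ∈ S | l.Prime})) :
    zetaTildeInv E.arith = (Module.finrank ℚ_[B.p] B.K : ℕ) := by
  letI := B.instPrime; letI := B.instField; letI := B.instAlgebra; letI := B.instFinite
  have hR := thm26_ii_delta_gal_holds B.p B.K
  have hl1 : ∀ (l : ℕ) [Fact l.Prime], l ≠ B.p → freeProlRank E.gal l = 1 := by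
    intro l _ hl
    rw [freeProlRank_eq_of_continuousMulEquiv B.galIso l]
    exact hR.1 l hl
  have hp1 : @freeProlRank E.gal _ _ B.p B.instPrime =
      ((1 + Module.finrank ℚ_[B.p] B.K : ℕ) : ℕ∞) := by
    rw [freeProlRank_eq_of_continuousMulEquiv B.galIso B.p, hR.2, Nat.add_comm]
  exact zetaTildeInv_eq_of_inputs E.aug E.aug_surjective
    (fun M hn hc hfg hapo => MLFBase.eq_bot_of_isAlmostProOmissive B M hn hc hfg hapo)
    B.p (Module.finrank ℚ_[B.p] B.K) hp1 hl1 hS hΔ hΔS hQ hiii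

/-- **[AbsTopI] Thm 2.6 (v), GENERAL form (`Θ ⊆ Π`, `ζ̃(Π) := ζ(Π/Θ)`) — a closer for the typed
`FundamentalExtension.Thm26vFull B`**, for EVERY extension `1 → Δ → Π → G → 1` with MLF base data
`G ≅ G_K` (`K/ℚ_p` finite) and construction-data prime set `Σ ⊆ Primes`, MODULO the named inputs:
(I1) `Δ` topologically finitely generated — [AbsTopI] Prop 2.2 BY NAME (`E.GeomTFG`);
(I2) `Δ` pro-`Σ` — the construction datum of Def 2.1 (i) (`IsProSet E.geom S`);
(I3) the rank identity extracted by the proof of (ii) (p. 23 l. 17–20: "`δ¹_l(Π) = δ¹_l(G) +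
  dim_{ℚ_l}(Q_l ⊗ ℚ_l)` [independent of `l`] for `l ∈ Σ`") for every open `Π′ ⊆ Π` — the `hQ` of
  `thm26ii_of_isProSet_of_rank`, quantified over the open subgroups (for `Σ = Primes` it is
  `exists_freeProlRank_open_eq_add` from a splitting and (∗));
(I4) Thm 2.6 (iii) for every open `H ⊆ Π` in the print-literal vocabulary `thetaSet`
  ("`θ²(H) ⊆ Σ`; if `|θ¹(H)| ≥ 2` then `θ²(H) = Σ`"; at `H = Π` this is `E.Thm26iii S` up to
  `thetaSet_eq_of_continuousMulEquiv`).
CONCLUSION: "`ζ̃(Π) := ζ(Π/Θ) = [k : ℚ_p]`" and "the kernel of the quotient `Π ↠ G` [is] the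
intersection of the open subgroups `H ⊆ Π` such that `ζ̃(H)/ζ̃(Π) = [Π : H]`".  Everything else the
printed proof (p. 24 l. 1–22) uses is a THEOREM of the tree consumed by name: elasticity of `G_k`
(Thm 1.7 (ii), `MLFBase.isElastic_gal`), "no almost pro-omissive open subgroup of `G_k`"
(`MLFBase.not_isAlmostProOmissive_of_isOpen`), the LCFT ranks of every `G′ ⊆ G`
(`thm26_ii_delta_gal_holds`, `freeProlRank_map_aug_of_rank`), `δ¹_l = dim H¹(−, ℚ_l)`
(`deltaInv_one_eq_freeProlRank`), and (iv) for every open `H` (derived here,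
`MLFBase.eq_bot_of_isAlmostProOmissive_of_isOpen`).  For `H` open: `ζ̃(H) = [G : G_H]·[K : ℚ_p]`
(`MLFBase.zetaTildeInv_eq_of_isOpen`), so `ζ̃(H) = [Π : H]·ζ̃(Π) ⟺ [G : G_H] = [Π : H] ⟺ Δ ⊆ H`,
and `Δ` is the intersection of the open subgroups containing it
(`ProfiniteGrp.closedSubgroup_eq_sInf_open`).  HONEST SCOPE: a closer MODULO the named rank input
(I3) and (iii)-for-open-`H` (I4); refereed, undisputed statement; nothing here bears on [IUTchIII]
Cor. 3.12. [cite: MochizukiAbsTopI2012, Thm 2.6 (v) p.22] -/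
theorem MLFBase.thm26vFull_of_rank_of_thm26iii_open (B : E.MLFBase) (S : Set ℕ)
    (hS : S ⊆ {q | q.Prime})
    (hΔ : E.GeomTFG) (hΔS : IsProSet E.geom S)
    (hQ : ∀ (P : Subgroup E.arith), IsOpen (P : Set E.arith) → ∃ m : ℕ, ∀ (l : ℕ) [Fact l.Prime],
      l ∈ S → freeProlRank P l = freeProlRank (P.map E.aug.toMonoidHom) l + m)
    (hiii : ∀ (H : Subgroup E.arith), IsOpen (H : Set E.arith) →
      thetaSet H 2 ⊆ {l ∈ S | l.Prime} ∧
        (2 ≤ (thetaSet H 1).encard → thetaSet H 2 = {l ∈ S | l.Prime})) :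
    E.Thm26vFull B := by
  letI := B.instPrime; letI := B.instField; letI := B.instAlgebra; letI := B.instFinite
  set d : ℕ := Module.finrank ℚ_[B.p] B.K with hd
  have hd0 : d ≠ 0 := Module.finrank_pos.ne'
  -- `ζ̃(H) = [G : G_H] · d` for every open `H`
  have hζ : ∀ (H : Subgroup E.arith), IsOpen (H : Set E.arith) →
      zetaTildeInv H = (((H.map E.aug.toMonoidHom).index * d : ℕ) : ℕ∞) := fun H hH =>
    MLFBase.zetaTildeInv_eq_of_isOpen B H hH hS hΔ hΔS (hQ H hH) (hiii H hH)
  -- `ζ̃(Π) = d`, transporting the inputs at `H = Π` along `⊤ ≅ Π`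
  have htop : IsOpen ((⊤ : Subgroup E.arith) : Set E.arith) := by
    rw [Subgroup.coe_top]; exact isOpen_univ
  obtain ⟨e⟩ := nonempty_continuousMulEquiv_of_eq_top (⊤ : Subgroup E.arith) rfl
  obtain ⟨e'⟩ := nonempty_continuousMulEquiv_of_eq_top
    ((⊤ : Subgroup E.arith).map E.aug.toMonoidHom) (Subgroup.map_top_of_surjective _ E.aug_surjective)
  have hQtop : ∃ m : ℕ, ∀ (l : ℕ) [Fact l.Prime], l ∈ S →
      freeProlRank E.arith l = freeProlRank E.gal l + m := by
    obtain ⟨m, hm⟩ := hQ ⊤ htop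
    refine ⟨m, fun l _ hl => ?_⟩
    rw [← freeProlRank_eq_of_continuousMulEquiv e l, hm l hl, freeProlRank_eq_of_continuousMulEquiv e' l]
  have hiiitop : thetaSet E.arith 2 ⊆ {l ∈ S | l.Prime} ∧
      (2 ≤ (thetaSet E.arith 1).encard → thetaSet E.arith 2 = {l ∈ S | l.Prime}) := by
    have h := hiii ⊤ htop
    rwa [thetaSet_eq_of_continuousMulEquiv e 2, thetaSet_eq_of_continuousMulEquiv e 1] at h
  have hζtop : zetaTildeInv E.arith = (d : ℕ∞) :=
    MLFBase.zetaTildeInv_arith_eq B hS hΔ hΔS hQtop hiiitop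
  refine ⟨hζtop, ?_⟩
  -- the condition `ζ̃(H) = [Π : H] · ζ̃(Π)` for open `H` says `Δ ⊆ H`
  have hiff : ∀ (H : Subgroup E.arith), IsOpen (H : Set E.arith) →
      (zetaTildeInv H = (H.index : ℕ∞) * zetaTildeInv E.arith ↔ E.geom ≤ H) := fun H hH => by
    haveI : Finite (E.arith ⧸ H) := Subgroup.quotient_finite_of_isOpen H hH
    haveI : H.FiniteIndex := Subgroup.finiteIndex_of_finite_quotient
    rw [hζ H hH, hζtop, ← Nat.cast_mul, ENat.coe_inj, geom_eq_ker]
    rw [show (H.map E.aug.toMonoidHom).index * d = H.index * d ↔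
        (H.map E.aug.toMonoidHom).index = H.index from
      ⟨fun h' => Nat.eq_of_mul_eq_mul_right (Nat.pos_of_ne_zero hd0) h', fun h' => by rw [h']⟩]
    exact index_map_eq_iff_ker_le' E.aug.toMonoidHom E.aug_surjective H
  -- `Δ` is the intersection of the open subgroups containing it
  have hΔ' : E.geom = sInf {N : Subgroup E.arith | IsOpen (N : Set E.arith) ∧ E.geom ≤ N} :=
    ProfiniteGrp.closedSubgroup_eq_sInf_open E.geomClosed
  refine le_antisymm ?_ ?_
  · exact le_iInf fun H => le_iInf fun hH => le_iInf fun hHζ => (hiff H hH).mp hHζ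
  · conv_rhs => rw [hΔ']
    refine le_sInf fun N hN => ?_
    exact iInf_le_of_le N (iInf_le_of_le hN.1 (iInf_le_of_le ((hiff N hN.1).mpr hN.2) le_rfl))

/-- **[AbsTopI] Thm 2.6 (v), general form, in the regime `Σ = Primes` of [IUTchI–III]**, from the
printed hypotheses of [AbsAnab] (= [Mzk6]) Lemma 1.1.4 (ii) — the citation "[cf. [Mzk6], Lemma 1.1.4,
(ii)]" of the proof, p. 24 l. 9 —: for EVERY extension `1 → Δ → Π → G → 1` with MLF base data
`G ≅ G_K` that splits over an open subgroup of `G` (`E.SplitsOverOpenSubgroup`), with `Δ` topologically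
finitely generated ([AbsTopI] Prop 2.2, `E.GeomTFG`) and satisfying (∗) (`E.StarCondition`), the rank
identity (I3) is a THEOREM (`exists_freeProlRank_open_eq_add`), `Δ` is trivially pro-`Primes`, and the
first clause of (iii) is vacuous; the ONLY remaining input is the second clause of Thm 2.6 (iii) for
every open `H ⊆ Π`: "if the cardinality of `θ¹(H)` is `≥ 2`, then `θ²(H) = Primes`".  Conclusion:
`E.Thm26vFull B`. [cite: MochizukiAbsTopI2012, Thm 2.6 (v) p.22] -/
theorem MLFBase.thm26vFull_of_starCondition_of_thm26iii_open (B : E.MLFBase)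
    (hs : E.SplitsOverOpenSubgroup) (hΔ : E.GeomTFG) (hstar : E.StarCondition)
    (hiii : ∀ (H : Subgroup E.arith), IsOpen (H : Set E.arith) →
      2 ≤ (thetaSet H 1).encard → thetaSet H 2 = {l | l.Prime}) :
    E.Thm26vFull B := by
  have hSP : {l ∈ {q : ℕ | q.Prime} | l.Prime} = {l | l.Prime} := by
    ext l
    simp only [Set.mem_setOf_eq, and_self]
  refine MLFBase.thm26vFull_of_rank_of_thm26iii_open B {q | q.Prime} subset_rfl hΔ
    ⟨fun U _ _ q hq _ => hq⟩ (fun P hP => ?_) (fun H hH => ⟨?_, fun h2 => ?_⟩)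
  · obtain ⟨m, hm⟩ := E.exists_freeProlRank_open_eq_add hs hstar P hP
    exact ⟨m, fun l _ _ => hm l⟩
  · rintro l ⟨hl, -⟩
    exact ⟨hl, hl⟩
  · rw [hiii H hH h2, hSP]

end FundamentalExtension

end Literature.AnabelianGeometry.AbsoluteAnabelian

end
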